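import Literature.NumberTheory.Irrationality.Fischler2002.Theoreme32StepProofs
import Literature.NumberTheory.Irrationality.Fischler2002.JnFinitenessCriterionProofs
import HarnessLib

/-!
# Fischler 2002, Théorème 3.2 — brick VI: on `𝓔` (`n ≥ 4`) the finiteness criterion is just `a_k ≥ 0`, `b_k ≥ 0`

Topic `Literature/NumberTheory/Irrationality/Fischler2002`. PROOFS ONLY (no definition, no statement, no discharge): sixth brick toward the
named fact `theoreme32` of `RhinViolaGroupsGeneral.lean`. The two remaining clauses are typed over pairs `p, gp` satisfying Fischler's
finiteness criterion `FinitenessCriterionGen` (« `a_k ≥ 0`, `b_k ≥ 0` et `ρ_k ≤ a_{k−1}` » [Fischler2002Polyzetas, §3 p. 4]); on the restricted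
family `𝓔` with `n ≥ 4` (`c₂ = ⋯ = c_{n−1} = 0`, `b_n = c_n`) the `ρ`-conditions are AUTOMATIC: `ρ_n = c_n − b_n = 0`, `ρ_k = −1 − b_k < 0`
(`2 ≤ k ≤ n−1`), `ρ₁ = −b₁ ≤ 0` (`rho_nonpos_of_InE`), so the criterion is exactly `a_k ≥ 0 ∧ b_k ≥ 0` (`crit_iff_nonneg_of_InE`). This is the
form in which the combinatorial path question of brick V (`transport`) is posed: the group permutes the coordinates' linear forms, and
`gp` satisfies the criterion iff finitely many explicit forms are non-negative at `p` (seat ct-1 g33's recon memo §5–6).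
Cell `pub-zeta5`, seat ct-1 g33, 2026-08-28.

HONEST FRAMING (cell pub-zeta5): systematic search; no irrationality claim — integer bookkeeping of a printed criterion; nothing about `ζ(5)`.
-/

namespace Literature.NumberTheory.Irrationality.Fischler2002

namespace Theoreme32

open JnFinite

/-- On `𝓔` with `n ≥ 4` and `b_k ≥ 0` (`1 ≤ k ≤ n`): `ρ_k ≤ 0` for every `k ≥ 1` (indeed `ρ_n = 0`, `ρ_k ≤ −1` for `2 ≤ k ≤ n−1`,
`ρ₁ = −b₁`). [cite: Fischler2002Polyzetas, §3 p. 4 (définition de ρ_k) and Théorème 3.2 (𝓔)] -/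
theorem rho_nonpos_of_InE {n : ℕ} (hn : 4 ≤ n) {p : Exponents} (hp : InE n p) (hb : ∀ k ∈ Finset.Icc 1 n, 0 ≤ p.b k) :
    ∀ k, 1 ≤ k → rho n p k ≤ 0 := by
  obtain ⟨hc, -, h4⟩ := hp
  obtain ⟨-, hbn, -⟩ := h4 hn
  -- descending induction on `m = n + 1 - k`
  have key : ∀ m k, n + 1 - k = m → 1 ≤ k → rho n p k ≤ 0 := by
    intro m
    induction m using Nat.strong_induction_on with
    | _ m ih =>
      intro k hm hk1
      rcases Nat.lt_or_ge n k with hlt | hle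
      · rw [rho_of_lt p hlt]
      · rw [rho_of_le p hle]
        have hrec : rho n p (k + 2) ≤ 0 := by
          rcases Nat.lt_or_ge n (k + 2) with h2 | h2
          · rw [rho_of_lt p h2]
          · exact ih (n + 1 - (k + 2)) (by omega) (k + 2) rfl (by omega)
        rw [max_eq_right hrec]
        have hbk := hb k (Finset.mem_Icc.2 ⟨hk1, hle⟩)
        by_cases hk1' : k = 1
        · subst hk1'
          rw [show cTilde n p 1 = 1 by simp [cTilde]]; linarith
        · by_cases hkn : k = n
          · subst hkn
            rw [show cTilde k p k = p.c k + 1 by simp [cTilde, hk1']]; linarith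
          · rw [show cTilde n p k = p.c k by simp [cTilde, hk1', hkn], hc k (by omega) (by omega)]; linarith
  exact fun k hk => key _ k rfl hk

/-- **On `𝓔` with `n ≥ 4`, Fischler's finiteness criterion is `a_k ≥ 0 ∧ b_k ≥ 0` (`1 ≤ k ≤ n`).**
[cite: Fischler2002Polyzetas, §3 p. 4 (critère de finitude) and Théorème 3.2 (𝓔)] -/
theorem crit_iff_nonneg_of_InE {n : ℕ} (hn : 4 ≤ n) {p : Exponents} (hp : InE n p) :
    FinitenessCriterionGen n p ↔ (∀ k ∈ Finset.Icc 1 n, 0 ≤ p.a k) ∧ (∀ k ∈ Finset.Icc 1 n, 0 ≤ p.b k) := by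
  refine ⟨fun h => ⟨h.1, h.2.1⟩, fun ⟨ha, hb⟩ => ⟨ha, hb, fun k hk => ?_⟩⟩
  have hk' := Finset.mem_Icc.1 hk
  refine le_trans (rho_nonpos_of_InE hn hp hb k hk'.1) ?_
  split_ifs with h1
  · exact le_rfl
  · exact ha (k - 1) (Finset.mem_Icc.2 ⟨by omega, by omega⟩)

/-- Consequently, for `n ≥ 4` a point of `𝓔` has `𝒥(p) < ∞` iff all `a_k, b_k ≥ 0` (`Jn_finite_iff_holds`).
[cite: Fischler2002Polyzetas, §3 p. 4 (critère de finitude) and Théorème 3.2 (𝓔)] -/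
theorem Jn_ne_top_iff_nonneg_of_InE {n : ℕ} (hn : 4 ≤ n) {p : Exponents} (hp : InE n p) :
    Jn n p ≠ ⊤ ↔ (∀ k ∈ Finset.Icc 1 n, 0 ≤ p.a k) ∧ (∀ k ∈ Finset.Icc 1 n, 0 ≤ p.b k) := by
  rw [Jn_finite_iff_holds n p (by omega), crit_iff_nonneg_of_InE hn hp]

end Theoreme32

end Literature.NumberTheory.Irrationality.Fischler2002
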